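import Summits.RiemannHypothesis.RiemannHypothesis.Theorems.LiAsymptoticModelLaplace
import Mathlib.MeasureTheory.Integral.Prod
import Mathlib.Analysis.SpecialFunctions.Integrability.Basic
import HarnessLib

/-!
# RiemannHypothesis / LiAsymptotic — crux K2 `LiSmoothMainTerm`, stub K2a part 2: `J₀ = π/2`, `J₁ = (π/2)(1 − γ)` (RH-FREE)

RH-FREE [rh-li-prover].  Route `Theses/LiAsymptotic.lean` (rung L-P(P1⁺) «Li asymptotic law, quadratic range»,
cell `pub/rh-li`, theory memo `theory/TARGETS.md` §11.2 STEP 6 (6c)), item `LiSmoothMainTerm`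
(stmt-RiemannHypothesis-19162), registered birth stub `stub_modelIntegral` (K2a), part 2: the two classical integrals
behind the Keiper–Lagarias main term,

  `J₀ = ∫_0^∞ (1 − cos u)/u² du = π/2`,   `J₁ = ∫_0^∞ (1 − cos u) log u/u² du = (π/2)(1 − γ)`.

Proof: FUBINI on `(0,∞)²` for `(1 − cos u) · x h(x) e^{−ux}` (absolutely integrable as soon as `|h(x)|/(1 + x²)` is):
`∫_u (1 − cos u) ∫_x x h(x) e^{−ux} dx du = ∫_x h(x)/(1 + x²) dx` (`∫_u (1 − cos u)e^{−xu} du = 1/(x(1 + x²))`, part 1).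
With `h ≡ 1` the inner integral is `1/u²` and the right side is `∫ dx/(1 + x²) = π/2`; with `h(x) = (1 − γ) − log x`
the inner integral is `log u/u²` (part 1: `∫ x log x e^{−ux} dx = (1 − γ − log u)/u²`) and the right side is
`(1 − γ)π/2 − ∫_0^∞ log x/(1 + x²) dx = (1 − γ)π/2` (the last integral vanishes under `x ↦ 1/x`).
Classical analysis; nothing here bears on the truth of RH.
-/

noncomputable section

-- D-0017: `Summit.<S>.<S>.…` is the designed namespace of a single-problem summit.
set_option linter.dupNamespace false

open MeasureTheory Set Filter Real
open scoped Topology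

namespace Summit.RiemannHypothesis.RiemannHypothesis.Theorems.LiTheory

namespace ModelIntegral

/-! ### The Fubini kernel -/

/-- **Fubini kernel.**  For measurable `h` with `|h(x)|/(1 + x²)` integrable on `(0, ∞)`:
`∫_{(0,∞)} (1 − cos u) (∫_{(0,∞)} x h(x) e^{−ux} dx) du = ∫_{(0,∞)} h(x)/(1 + x²) dx`. -/
theorem fubini_kernel {h : ℝ → ℝ} (hm : Measurable h)
    (hint : IntegrableOn (fun x : ℝ ↦ |h x| / (1 + x ^ 2)) (Ioi 0)) :
    ∫ u in Ioi (0 : ℝ), (1 - Real.cos u) * ∫ x in Ioi (0 : ℝ), x * h x * Real.exp (-(u * x)) =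
      ∫ x in Ioi (0 : ℝ), h x / (1 + x ^ 2) := by
  set μ : Measure ℝ := volume.restrict (Ioi (0 : ℝ)) with hμ
  set f : ℝ → ℝ → ℝ := fun x u ↦ (1 - Real.cos u) * (x * h x * Real.exp (-(u * x))) with hf
  -- pointwise rearrangement of `f x` as a constant multiple of the Laplace integrand
  have hfx : ∀ x u : ℝ, f x u = (x * h x) * ((1 - Real.cos u) * Real.exp (-(x * u))) := by
    intro x u; simp only [hf]; rw [mul_comm u x]; ring
  -- inner `u`-integrals
  have hinner : ∀ x : ℝ, 0 < x → ∫ u in Ioi (0 : ℝ), f x u = h x / (1 + x ^ 2) := by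
    intro x hx
    simp_rw [hfx x]
    rw [integral_const_mul, integral_one_sub_cos_mul_exp hx]
    field_simp
  have hinner_norm : ∀ x : ℝ, 0 < x → ∫ u in Ioi (0 : ℝ), ‖f x u‖ = |h x| / (1 + x ^ 2) := by
    intro x hx
    have e : ∀ u : ℝ, ‖f x u‖ = |x * h x| * ((1 - Real.cos u) * Real.exp (-(x * u))) := by
      intro u
      rw [hfx x u, Real.norm_eq_abs, abs_mul, abs_of_nonneg (mul_nonneg (by linarith [Real.cos_le_one u]) (Real.exp_pos _).le)]
    simp_rw [e]
    rw [integral_const_mul, integral_one_sub_cos_mul_exp hx, abs_mul, abs_of_pos hx]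
    field_simp
  -- integrability on the product
  have hmeas : AEStronglyMeasurable (Function.uncurry f) (μ.prod μ) := by
    refine Measurable.aestronglyMeasurable ?_
    have : Function.uncurry f = fun p : ℝ × ℝ ↦ (1 - Real.cos p.2) * (p.1 * h p.1 * Real.exp (-(p.2 * p.1))) := by
      funext p; rfl
    rw [this]
    exact ((measurable_const.sub (Real.measurable_cos.comp measurable_snd)).mul
      ((measurable_fst.mul (hm.comp measurable_fst)).mul
        (Real.measurable_exp.comp ((measurable_snd.mul measurable_fst).neg))))
  have hF : Integrable (Function.uncurry f) (μ.prod μ) := by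
    rw [integrable_prod_iff hmeas]
    constructor
    · rw [hμ]
      filter_upwards [ae_restrict_mem measurableSet_Ioi] with x hx
      have hx0 : 0 < x := hx
      have hI : IntegrableOn (fun u : ℝ ↦ (x * h x) * ((1 - Real.cos u) * Real.exp (-(x * u)))) (Ioi 0) :=
        (integrableOn_one_sub_cos_mul_exp hx0).const_mul (x * h x)
      exact hI.congr_fun (fun u _ ↦ (hfx x u).symm) measurableSet_Ioi
    · rw [hμ]
      refine hint.congr_fun (fun x hx ↦ ?_) measurableSet_Ioi
      exact (hinner_norm x hx).symm
  have hswap := integral_integral_swap hF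
  -- left side (outer `x`)
  have hL : ∫ x in Ioi (0 : ℝ), ∫ u in Ioi (0 : ℝ), f x u = ∫ x in Ioi (0 : ℝ), h x / (1 + x ^ 2) :=
    setIntegral_congr_fun measurableSet_Ioi fun x hx ↦ hinner x hx
  -- right side (outer `u`)
  have hR : ∫ u in Ioi (0 : ℝ), ∫ x in Ioi (0 : ℝ), f x u =
      ∫ u in Ioi (0 : ℝ), (1 - Real.cos u) * ∫ x in Ioi (0 : ℝ), x * h x * Real.exp (-(u * x)) := by
    refine setIntegral_congr_fun measurableSet_Ioi fun u _ ↦ ?_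
    simp only [hf]
    rw [integral_const_mul]
  rw [← hR, ← hswap, hL]

/-! ### `log x/(1 + x²)` on `(0, ∞)` -/

/-- `log x/x²` is integrable on `(1, ∞)` (antiderivative `−(log x + 1)/x → 0`). -/
theorem integrableOn_log_div_sq_Ioi_one : IntegrableOn (fun x : ℝ ↦ Real.log x / x ^ 2) (Ioi 1) := by
  have hderiv : ∀ x ∈ Ici (1 : ℝ), HasDerivAt (fun y : ℝ ↦ -((Real.log y + 1) / y)) (Real.log x / x ^ 2) x := by
    intro x hx
    have hx0 : x ≠ 0 := by linarith [mem_Ici.1 hx]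
    have h1 : HasDerivAt (fun y : ℝ ↦ Real.log y + 1) x⁻¹ x := by
      simpa using (Real.hasDerivAt_log hx0).add_const 1
    refine ((h1.div (hasDerivAt_id x) hx0).neg).congr_deriv ?_
    simp only [id]
    field_simp
    ring
  have hpos : ∀ x ∈ Ioi (1 : ℝ), 0 ≤ Real.log x / x ^ 2 := fun x hx ↦
    div_nonneg (Real.log_nonneg (le_of_lt (mem_Ioi.1 hx))) (sq_nonneg _)
  have hlim : Tendsto (fun y : ℝ ↦ -((Real.log y + 1) / y)) atTop (𝓝 0) := by
    have h1 : Tendsto (fun y : ℝ ↦ Real.log y ^ 1 / (1 * y + 0)) atTop (𝓝 0) :=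
      Real.tendsto_pow_log_div_mul_add_atTop 1 0 1 one_ne_zero
    have h2 : Tendsto (fun y : ℝ ↦ y⁻¹) atTop (𝓝 0) := tendsto_inv_atTop_zero
    have h := (h1.add h2).neg
    simp only [pow_one, one_mul, add_zero, neg_zero] at h
    refine h.congr' ?_
    filter_upwards [eventually_gt_atTop (0 : ℝ)] with y hy
    field_simp
  exact integrableOn_Ioi_deriv_of_nonneg' hderiv hpos hlim

/-- `|log x|/(1 + x²)` is integrable on `(0, ∞)`. -/
theorem integrableOn_abs_log_div : IntegrableOn (fun x : ℝ ↦ |Real.log x| / (1 + x ^ 2)) (Ioi 0) := by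
  have hcont : ContinuousOn (fun x : ℝ ↦ |Real.log x| / (1 + x ^ 2)) (Ioi 0) := by
    refine continuousOn_of_forall_continuousAt fun x hx ↦ ?_
    have h1 : x ≠ 0 := (mem_Ioi.1 hx).ne'
    have h2 : (1 : ℝ) + x ^ 2 ≠ 0 := by positivity
    fun_prop (disch := assumption)
  -- `(0, 1]`: dominated by `|log x|`
  have h01 : IntegrableOn (fun x : ℝ ↦ |Real.log x| / (1 + x ^ 2)) (Ioc 0 1) := by
    have hlog : IntegrableOn (fun x : ℝ ↦ |Real.log x|) (Ioc 0 1) :=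
      ((intervalIntegrable_iff_integrableOn_Ioc_of_le zero_le_one).1 intervalIntegral.intervalIntegrable_log').norm
    refine Integrable.mono' hlog ((hcont.mono Ioc_subset_Ioi_self).aestronglyMeasurable measurableSet_Ioc) ?_
    filter_upwards [ae_restrict_mem measurableSet_Ioc] with x hx
    rw [Real.norm_eq_abs, abs_div, abs_abs, abs_of_pos (by positivity : (0 : ℝ) < 1 + x ^ 2)]
    exact div_le_self (abs_nonneg _) (by nlinarith)
  -- `(1, ∞)`: dominated by `log x/x²`
  have h1 : IntegrableOn (fun x : ℝ ↦ |Real.log x| / (1 + x ^ 2)) (Ioi 1) := by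
    refine Integrable.mono' integrableOn_log_div_sq_Ioi_one
      ((hcont.mono (Ioi_subset_Ioi zero_le_one)).aestronglyMeasurable measurableSet_Ioi) ?_
    filter_upwards [ae_restrict_mem measurableSet_Ioi] with x hx
    have hx1 : 1 < x := mem_Ioi.1 hx
    rw [Real.norm_eq_abs, abs_div, abs_abs, abs_of_pos (by positivity : (0 : ℝ) < 1 + x ^ 2),
      abs_of_nonneg (Real.log_nonneg hx1.le)]
    exact div_le_div_of_nonneg_left (Real.log_nonneg hx1.le) (by positivity) (by nlinarith)
  rw [← Ioc_union_Ioi_eq_Ioi zero_le_one]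
  exact h01.union h1

/-- `log x/(1 + x²)` is integrable on `(0, ∞)`. -/
theorem integrableOn_log_div : IntegrableOn (fun x : ℝ ↦ Real.log x / (1 + x ^ 2)) (Ioi 0) := by
  have hcont : ContinuousOn (fun x : ℝ ↦ Real.log x / (1 + x ^ 2)) (Ioi 0) := by
    refine continuousOn_of_forall_continuousAt fun x hx ↦ ?_
    have h1 : x ≠ 0 := (mem_Ioi.1 hx).ne'
    have h2 : (1 : ℝ) + x ^ 2 ≠ 0 := by positivity
    fun_prop (disch := assumption)
  refine Integrable.mono' integrableOn_abs_log_div (hcont.aestronglyMeasurable measurableSet_Ioi) ?_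
  filter_upwards [ae_restrict_mem measurableSet_Ioi] with x _
  rw [Real.norm_eq_abs, abs_div, abs_of_pos (by positivity : (0 : ℝ) < 1 + x ^ 2)]

/-- `∫_{(0,∞)} log x/(1 + x²) dx = 0` (the substitution `x ↦ 1/x` reverses the sign). -/
theorem integral_log_div_one_add_sq : ∫ x in Ioi (0 : ℝ), Real.log x / (1 + x ^ 2) = 0 := by
  have h := integral_comp_rpow_Ioi (fun y : ℝ ↦ Real.log y / (1 + y ^ 2)) (p := -1) (by norm_num)
  have hlhs : ∫ x in Ioi (0 : ℝ), (|(-1 : ℝ)| * x ^ ((-1 : ℝ) - 1)) • (Real.log (x ^ (-1 : ℝ)) / (1 + (x ^ (-1 : ℝ)) ^ 2)) =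
      ∫ x in Ioi (0 : ℝ), -(Real.log x / (1 + x ^ 2)) := by
    refine setIntegral_congr_fun measurableSet_Ioi fun x hx ↦ ?_
    have hx0 : 0 < x := mem_Ioi.1 hx
    rw [Real.rpow_neg_one, Real.log_inv, show ((-1 : ℝ) - 1) = -((2 : ℕ) : ℝ) by norm_num,
      Real.rpow_neg hx0.le, Real.rpow_natCast, smul_eq_mul]
    have hx2 : x ^ 2 ≠ 0 := by positivity
    field_simp
    ring
  rw [hlhs, integral_neg] at h
  linarith

/-! ### The two classical integrals -/

/-- **`J₀ = ∫_{(0,∞)} (1 − cos u)/u² du = π/2`.** -/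
theorem integral_one_sub_cos_div_sq : ∫ u in Ioi (0 : ℝ), (1 - Real.cos u) / u ^ 2 = π / 2 := by
  have hint : IntegrableOn (fun x : ℝ ↦ |(1 : ℝ)| / (1 + x ^ 2)) (Ioi 0) := by
    simpa using (integrable_inv_one_add_sq.integrableOn : IntegrableOn (fun x : ℝ ↦ (1 + x ^ 2)⁻¹) (Ioi 0))
  have hk := fubini_kernel (h := fun _ ↦ (1 : ℝ)) measurable_const hint
  have hL : ∫ u in Ioi (0 : ℝ), (1 - Real.cos u) * ∫ x in Ioi (0 : ℝ), x * (1 : ℝ) * Real.exp (-(u * x)) =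
      ∫ u in Ioi (0 : ℝ), (1 - Real.cos u) / u ^ 2 := by
    refine setIntegral_congr_fun measurableSet_Ioi fun u hu ↦ ?_
    simp_rw [mul_one]
    rw [integral_id_mul_exp_neg_mul (mem_Ioi.1 hu)]
    ring
  have hR : ∫ x in Ioi (0 : ℝ), (1 : ℝ) / (1 + x ^ 2) = π / 2 := by
    have := integral_Ioi_inv_one_add_sq (i := 0)
    rw [Real.arctan_zero, sub_zero] at this
    rw [← this]
    exact setIntegral_congr_fun measurableSet_Ioi fun x _ ↦ by rw [one_div]
  rw [← hL, hk, hR]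

/-- **`J₁ = ∫_{(0,∞)} (1 − cos u) log u/u² du = (π/2)(1 − γ)`.** -/
theorem integral_one_sub_cos_mul_log_div_sq :
    ∫ u in Ioi (0 : ℝ), (1 - Real.cos u) * Real.log u / u ^ 2 = π / 2 * (1 - Real.eulerMascheroniConstant) := by
  set c : ℝ := 1 - Real.eulerMascheroniConstant with hc
  have hint : IntegrableOn (fun x : ℝ ↦ |c - Real.log x| / (1 + x ^ 2)) (Ioi 0) := by
    have hdom : IntegrableOn (fun x : ℝ ↦ |c| / (1 + x ^ 2) + |Real.log x| / (1 + x ^ 2)) (Ioi 0) := by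
      refine IntegrableOn.add ?_ integrableOn_abs_log_div
      have h1 : IntegrableOn (fun x : ℝ ↦ |c| * (1 + x ^ 2)⁻¹) (Ioi 0) :=
        (integrable_inv_one_add_sq.const_mul |c|).integrableOn
      exact h1.congr_fun (fun x _ ↦ by rw [div_eq_mul_inv]) measurableSet_Ioi
    have hcont : ContinuousOn (fun x : ℝ ↦ |c - Real.log x| / (1 + x ^ 2)) (Ioi 0) := by
      refine continuousOn_of_forall_continuousAt fun x hx ↦ ?_
      have h1 : x ≠ 0 := (mem_Ioi.1 hx).ne'
      have h2 : (1 : ℝ) + x ^ 2 ≠ 0 := by positivity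
      fun_prop (disch := assumption)
    refine Integrable.mono' hdom (hcont.aestronglyMeasurable measurableSet_Ioi) ?_
    filter_upwards [ae_restrict_mem measurableSet_Ioi] with x _
    rw [Real.norm_eq_abs, abs_div, abs_abs, abs_of_pos (by positivity : (0 : ℝ) < 1 + x ^ 2), ← add_div]
    exact div_le_div_of_nonneg_right (abs_sub _ _) (by positivity)
  have hk := fubini_kernel (h := fun x ↦ c - Real.log x) (measurable_const.sub Real.measurable_log) hint
  -- the inner integral is `log u/u²`
  have hL : ∫ u in Ioi (0 : ℝ), (1 - Real.cos u) * ∫ x in Ioi (0 : ℝ), x * (c - Real.log x) * Real.exp (-(u * x)) =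
      ∫ u in Ioi (0 : ℝ), (1 - Real.cos u) * Real.log u / u ^ 2 := by
    refine setIntegral_congr_fun measurableSet_Ioi fun u hu ↦ ?_
    have hu0 : 0 < u := mem_Ioi.1 hu
    have e : ∀ x : ℝ, x * (c - Real.log x) * Real.exp (-(u * x)) =
        c * (x * Real.exp (-(u * x))) - x * Real.log x * Real.exp (-(u * x)) := fun x ↦ by ring
    simp_rw [e]
    rw [integral_sub ((integrableOn_id_mul_exp_neg_mul hu0).const_mul c) (integrableOn_id_mul_log_mul_exp_neg_mul hu0),
      integral_const_mul, integral_id_mul_exp_neg_mul hu0, integral_id_mul_log_mul_exp_neg_mul hu0, hc]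
    field_simp
    ring
  -- the right side is `c π/2 − 0`
  have hR : ∫ x in Ioi (0 : ℝ), (c - Real.log x) / (1 + x ^ 2) = π / 2 * c := by
    have e : ∀ x : ℝ, (c - Real.log x) / (1 + x ^ 2) = c * (1 + x ^ 2)⁻¹ - Real.log x / (1 + x ^ 2) := fun x ↦ by
      rw [sub_div, div_eq_mul_inv]
    simp_rw [e]
    rw [integral_sub (integrable_inv_one_add_sq.integrableOn.const_mul c) integrableOn_log_div, integral_const_mul,
      integral_Ioi_inv_one_add_sq, integral_log_div_one_add_sq, Real.arctan_zero]
    ring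
  rw [← hL, hk, hR]

end ModelIntegral

end Summit.RiemannHypothesis.RiemannHypothesis.Theorems.LiTheory

end
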